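/-
Copyright (c) 2026 the pub-hodgecm-mathlib formalisation cell (harness21).  Prover seat hodgecm-mathlib-LH10-p01 (g10): road «M6 ∕ F3 TOT-Λ BY OVER-ORDERS»
(LEAD T14-66; SIG-F3-5 v1 6925585c (S3) «partition», carve (c13) for the F3-5 pen LH7-p04 (g12)), 2026-09-03: the three hypotheses `h𝓞`, `hcov`, `h𝓞fin` of ★ F3-2b's
partition `setOf_selfDual_stable_eq_biUnion` ∕ `ncard_setOf_selfDual_stable_eq_finsum`, discharged for THE GLUED FAMILY — the `incl`-images of the finitely many over-orders
of the type-(2) order `R = 𝒪_E[(u, λ)] = G(N, n, c)` (★ (c3) exhaustion + ★ (c4) integral reading).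
-/
import Literature.NumberTheory.Automorphic.GluedOverOrdersExhaustion   -- ★ (c3) p853024 (this seat): `exists_coe_eq_glued_of_glued_subset`, `finite_setOf_subring_glued_subset`; brings ★ F3-1a `GluedOverOrders` (`gen_mem_glued`)
import Literature.NumberTheory.Automorphic.SelfDualOverOrderPartition  -- ★ F3-2b FILE 2 p852999 (LH7-p04 (g11)): the partition whose `h𝓞 ∕ hcov ∕ h𝓞fin` this file discharges, and its (B1) `exists_subring_span_image_eq_of_selfDual`, `exists_linearEquiv_eq_mulVec`; brings `unitaryGroupOfForm`
import Literature.NumberTheory.Automorphic.OverOrderIntegralReading    -- ★ (c4) p853025 (this seat): `mk_mem_comap_prodMap_subtype`, `coe_subset_range_prodMap_subtype_of_coe_eq`, `map_comap_prodMap_subtype_eq`, `comap_map_prodMap_subtype_eq`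
import HarnessLib

/-!
# The glued family of over-orders satisfies the hypotheses of ★ F3-2b's partition

Topic `NumberTheory/Automorphic`; namespace `Literature.NumberTheory.Automorphic`.  THEOREMS ONLY (no definition, no instance, no notation, no named fact, no `sorry`).
Cell `pub/hodgecm-mathlib` (D-0151), crux H413 = `stmt-HodgeConjecture-24833`; road M6 → F3 «TOT-Λ by over-orders», step (S3) of SIG-F3-5 v1.

FRAME = ★ (D3)∕(c4): valued fields `E ⊆ K` (`algebraMap`, `jO : 𝒪_E →+* 𝒪_K` over it), `incl = (coe, coe) : 𝒪_E × 𝒪_K → E × K`; the Eisenstein ring structure of ★ F3-1a ∕ (c3) on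
`O₁ := 𝒪_K` (`θ : 𝒪_K`, `θ² = jO a·θ + jO k`, unique coordinates `hcoord`, `ϖO` irreducible, `𝒪_E` a DVR); the type-(2) order `R = range (eval₂ (id × jO) (uO, λO))`
READ AS A GLUED ORDER `↑R = G(N, n, c)` (★-to-be (c6) «R is glued», LH4-p01 (g10) — a HYPOTHESIS `hR` here); the endoscopic generator `τB = incl (uO, λO) ∈ E × K`.
THE FAMILY: `𝓢 = {S ≤ 𝒪_E × 𝒪_K | δ(𝒪_E) ⊆ S ∧ G(N, n, c) ⊆ S}` (finite, ★ (c3)), `𝓞 = incl '' 𝓢 ⊆ Subring (E × K)`.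

* §1 `eval₂_range_le_of_mem` — a subring over the diagonal containing `(uO, λO)` contains `R`; `algebraMap_eq_prodMap_mk` (`algebraMap E (E × K) r = incl (r, jO r)`).
* §2 `finite_image_map_glued_family` (`h𝓞fin`); `scalars_mem_and_gen_mem_of_mem_image` (`h𝓞`: scalars and `τB` lie in every member).
* §3 **`exists_mem_image_coe_eq_of_multiplier`** (`hcov`): if `O ≤ E × K` contains the scalars, `τB ∈ O`, and `↑O ⊆ range incl` (★ (c4) `coe_subset_range_prodMap_subtype_of_coe_eq`
  gives this for the multiplier subring `↑O = {x | φ(x)Λ(u) ⊆ Λ(u)}` of ★ F3-2b (B1)), then `O ∈ 𝓞`.  Packaged for ★ F3-2b's literal `hcov` shape: **`hcov_glued_family`**, taking (B1)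
  as the hypothesis `hB1` and the orbit isomorphism `Ψ` of ★ F3-2b `exists_linearEquiv_eq_mulVec`.

References: [Neukirch1999] J. Neukirch, *Algebraic Number Theory*, Grundlehren 322 (1999), Ch. I §12 (orders between an order and the maximal order; conductor);
[Jacobowitz1962] R. Jacobowitz, *Hermitian forms over local fields*, Amer. J. Math. 84 (1962), §7 (multiplier orders of hermitian lattices); [Bass1963] H. Bass, *On the
ubiquity of Gorenstein rings*, Math. Z. 82 (1963), §7; [Rogawski1990] J. Rogawski, *Automorphic representations of unitary groups in three variables*, §4.9 Lemma 4.9.3 p. 56.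
-/

set_option autoImplicit false

noncomputable section

open scoped ValuativeRel Matrix MatrixGroups
open ValuativeRel Polynomial Matrix Literature.NumberTheory.Automorphic.UnitaryGroup

namespace Literature.NumberTheory.Automorphic

variable {E : Type*} [Field E] [ValuativeRel E] {K : Type*} [Field K] [ValuativeRel K] [Algebra E K]
  (jO : 𝒪[E] →+* 𝒪[K]) (hjO : ∀ x : 𝒪[E], ((jO x : 𝒪[K]) : K) = algebraMap E K x)

/-! ## §1 Subrings over the diagonal containing the generator contain `R` -/

omit [Algebra E K] in
/-- A subring `S ≤ 𝒪_E × 𝒪_K` containing the diagonal `(y, jO y)` and the pair `x = (uO, λO)` contains `R = 𝒪_E[x] = range (eval₂ (id × jO) x)`.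
[cite: Neukirch1999, Ch. I §12] -/
theorem eval₂_range_le_of_mem (S : Subring (𝒪[E] × 𝒪[K])) (hδ : ∀ y : 𝒪[E], ((y, jO y) : 𝒪[E] × 𝒪[K]) ∈ S) (x : 𝒪[E] × 𝒪[K]) (hx : x ∈ S) :
    (Polynomial.eval₂RingHom (RingHom.prod (RingHom.id 𝒪[E]) jO) x).range ≤ S := by
  rintro _ ⟨P, rfl⟩
  rw [Polynomial.coe_eval₂RingHom]
  induction P using Polynomial.induction_on' with
  | add p q hp hq => rw [Polynomial.eval₂_add]; exact S.add_mem hp hq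
  | monomial m r =>
    rw [Polynomial.eval₂_monomial]
    exact S.mul_mem (hδ r) (S.pow_mem hx m)

include hjO in
/-- `algebraMap E (E × K) r = incl (r, jO r)` for `r ∈ 𝒪_E`. [cite: Neukirch1999, Ch. I §12] -/
theorem algebraMap_eq_prodMap_mk (r : 𝒪[E]) :
    algebraMap E (E × K) (r : E) = RingHom.prodMap (𝒪[E]).subtype (𝒪[K]).subtype ((r, jO r) : 𝒪[E] × 𝒪[K]) := by
  rw [Prod.algebraMap_apply, Algebra.algebraMap_self, RingHom.id_apply, ← hjO]; rfl

/-! ## §2 The glued family: finite, and every member contains the scalars and the generator -/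

section Family

variable (θ : 𝒪[K]) {a k : 𝒪[E]} (ϖO : 𝒪[E]) (hθ : θ * θ = jO a * θ + jO k)
  (hcoord : ∀ z : 𝒪[K], ∃! bc : 𝒪[E] × 𝒪[E], z = jO bc.1 + jO bc.2 * θ)

omit [Algebra E K] in
include hθ hcoord in
/-- **`h𝓞fin`**: the `incl`-image of the family of subrings `S ⊇ δ(𝒪_E) ∪ G(N, n, c)` is finite (★ (c3) `finite_setOf_subring_glued_subset`). [cite: Neukirch1999, Ch. I §12] -/
theorem finite_image_map_glued_family [IsDiscreteValuationRing 𝒪[E]] (hϖ : Irreducible ϖO) {N n : ℕ} (c : 𝒪[E])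
    [Finite (𝒪[E] ⧸ Ideal.span {ϖO ^ n})] :
    ((fun S : Subring (𝒪[E] × 𝒪[K]) => S.map (RingHom.prodMap (𝒪[E]).subtype (𝒪[K]).subtype)) ''
      {S : Subring (𝒪[E] × 𝒪[K]) | (∀ y : 𝒪[E], ((y, jO y) : 𝒪[E] × 𝒪[K]) ∈ S) ∧
        {z : 𝒪[E] × 𝒪[K] | ∃ b₀ c₀ : 𝒪[E], z.2 = jO b₀ + jO c₀ * (jO (ϖO ^ N) * θ) ∧ z.1 - (b₀ + c₀ * c) ∈ Ideal.span {ϖO ^ n}} ⊆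
          (S : Set (𝒪[E] × 𝒪[K]))}).Finite :=
  (finite_setOf_subring_glued_subset jO θ ϖO hθ hcoord hϖ c).image _

include hjO in
/-- **`h𝓞`**: every member `O = incl S` of the glued family contains the scalars `algebraMap E (E × K) r` (`r ∈ 𝒪_E`; from the diagonal) and the generator
`τB = incl (uO, λO)` (from `R = 𝒪_E[(uO, λO)] ⊆ S`, given `↑R = G(N, n, c)`). [cite: Neukirch1999, Ch. I §12] [cite: Rogawski1990, §4.9 Lemma 4.9.3 p. 56] -/
theorem scalars_mem_and_gen_mem_of_mem_image {N n : ℕ} {c : 𝒪[E]} (uO : 𝒪[E]) (lamO : 𝒪[K])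
    (hR : ((Polynomial.eval₂RingHom (RingHom.prod (RingHom.id 𝒪[E]) jO) (uO, lamO)).range : Set (𝒪[E] × 𝒪[K])) =
      {z : 𝒪[E] × 𝒪[K] | ∃ b₀ c₀ : 𝒪[E], z.2 = jO b₀ + jO c₀ * (jO (ϖO ^ N) * θ) ∧ z.1 - (b₀ + c₀ * c) ∈ Ideal.span {ϖO ^ n}})
    (O : Subring (E × K))
    (hO : O ∈ (fun S : Subring (𝒪[E] × 𝒪[K]) => S.map (RingHom.prodMap (𝒪[E]).subtype (𝒪[K]).subtype)) ''
      {S : Subring (𝒪[E] × 𝒪[K]) | (∀ y : 𝒪[E], ((y, jO y) : 𝒪[E] × 𝒪[K]) ∈ S) ∧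
        {z : 𝒪[E] × 𝒪[K] | ∃ b₀ c₀ : 𝒪[E], z.2 = jO b₀ + jO c₀ * (jO (ϖO ^ N) * θ) ∧ z.1 - (b₀ + c₀ * c) ∈ Ideal.span {ϖO ^ n}} ⊆
          (S : Set (𝒪[E] × 𝒪[K]))}) :
    (∀ r : 𝒪[E], algebraMap E (E × K) (r : E) ∈ O) ∧
      RingHom.prodMap (𝒪[E]).subtype (𝒪[K]).subtype ((uO, lamO) : 𝒪[E] × 𝒪[K]) ∈ O := by
  obtain ⟨S, ⟨hδ, hRS⟩, rfl⟩ := hO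
  refine ⟨fun r => ?_, ?_⟩
  · rw [algebraMap_eq_prodMap_mk jO hjO]
    exact Subring.mem_map.2 ⟨_, hδ r, rfl⟩
  · refine Subring.mem_map.2 ⟨_, hRS ?_, rfl⟩
    rw [← hR]
    exact ⟨Polynomial.X, by simp⟩

end Family

/-! ## §3 `hcov`: the multiplier subring of a self-dual `τ`-stable lattice lies in the family -/

section Cover

variable (θ : 𝒪[K]) {a k : 𝒪[E]} (ϖO : 𝒪[E]) (hθ : θ * θ = jO a * θ + jO k)
  (hcoord : ∀ z : 𝒪[K], ∃! bc : 𝒪[E] × 𝒪[E], z = jO bc.1 + jO bc.2 * θ)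

include hjO in
/-- **A SUBRING OVER THE SCALARS, CONTAINING `τB`, INSIDE THE MAXIMAL ORDER, LIES IN THE GLUED FAMILY.**  If `O ≤ E × K` contains every `algebraMap E (E × K) r` (`r ∈ 𝒪_E`),
contains `τB = incl (uO, λO)`, and `↑O ⊆ range incl`, then `O = incl S` with `S = incl⁻¹ O ⊇ δ(𝒪_E) ∪ R`, `↑R = G(N, n, c)` — so `O ∈ 𝓞`. [cite: Neukirch1999, Ch. I §12] -/
theorem mem_image_glued_family_of_subset_range {N n : ℕ} {c : 𝒪[E]} (uO : 𝒪[E]) (lamO : 𝒪[K])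
    (hR : ((Polynomial.eval₂RingHom (RingHom.prod (RingHom.id 𝒪[E]) jO) (uO, lamO)).range : Set (𝒪[E] × 𝒪[K])) =
      {z : 𝒪[E] × 𝒪[K] | ∃ b₀ c₀ : 𝒪[E], z.2 = jO b₀ + jO c₀ * (jO (ϖO ^ N) * θ) ∧ z.1 - (b₀ + c₀ * c) ∈ Ideal.span {ϖO ^ n}})
    (O : Subring (E × K)) (hOsc : ∀ r : 𝒪[E], algebraMap E (E × K) (r : E) ∈ O)
    (hOτ : RingHom.prodMap (𝒪[E]).subtype (𝒪[K]).subtype ((uO, lamO) : 𝒪[E] × 𝒪[K]) ∈ O)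
    (hOint : (O : Set (E × K)) ⊆ Set.range (RingHom.prodMap (𝒪[E]).subtype (𝒪[K]).subtype)) :
    O ∈ (fun S : Subring (𝒪[E] × 𝒪[K]) => S.map (RingHom.prodMap (𝒪[E]).subtype (𝒪[K]).subtype)) ''
      {S : Subring (𝒪[E] × 𝒪[K]) | (∀ y : 𝒪[E], ((y, jO y) : 𝒪[E] × 𝒪[K]) ∈ S) ∧
        {z : 𝒪[E] × 𝒪[K] | ∃ b₀ c₀ : 𝒪[E], z.2 = jO b₀ + jO c₀ * (jO (ϖO ^ N) * θ) ∧ z.1 - (b₀ + c₀ * c) ∈ Ideal.span {ϖO ^ n}} ⊆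
          (S : Set (𝒪[E] × 𝒪[K]))} := by
  set S : Subring (𝒪[E] × 𝒪[K]) := O.comap (RingHom.prodMap (𝒪[E]).subtype (𝒪[K]).subtype) with hS
  have hδ : ∀ y : 𝒪[E], ((y, jO y) : 𝒪[E] × 𝒪[K]) ∈ S := fun y => mk_mem_comap_prodMap_subtype jO hjO O hOsc y
  have hx : ((uO, lamO) : 𝒪[E] × 𝒪[K]) ∈ S := Subring.mem_comap.2 hOτ
  refine ⟨S, ⟨hδ, ?_⟩, map_comap_prodMap_subtype_eq O hOint⟩
  rw [← hR]
  exact eval₂_range_le_of_mem jO S hδ _ hx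

include hjO in
/-- **`hcov` FOR THE GLUED FAMILY** — ★ F3-2b `setOf_selfDual_stable_eq_biUnion`'s literal covering hypothesis.  Inputs: the multiplier-ring structure theorem (B1) of ★ F3-2b
as the hypothesis `hB1` (for every self-dual `Λ = Λ(g)`, a subring `O(Λ)` over the scalars with `↑O(Λ) = {x | φ(x)Λ ⊆ Λ}`), the orbit isomorphism `Ψ b = φ(b)·w₀`
(★ F3-2b `exists_linearEquiv_eq_mulVec`), `algebraMap` integral on `𝒪_E`, `φ τB = τ` with `τB = incl (uO, λO)` and `↑𝒪_E[(uO, λO)] = G(N, n, c)`.  Then every self-dual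
`τ`-stable `Λ` has its multiplier set equal to `↑O` for some `O` in the glued family: `τ`-stability puts `τB` in `O(Λ)`, ★ (c4) puts `O(Λ)` inside the maximal order, §3 puts it in
the family. [cite: Jacobowitz1962, §7] [cite: Neukirch1999, Ch. I §12] [cite: Rogawski1990, §4.9 Lemma 4.9.3 p. 56] -/
theorem hcov_glued_family (hOK : ∀ r : 𝒪[E], algebraMap E K (r : E) ∈ 𝒪[K]) {m : ℕ} (σ : E →+* E) (J : GL (Fin m) E)
    (φ : (E × K) →ₐ[E] Matrix (Fin m) (Fin m) E) (Ψ : (E × K) ≃ₗ[E] (Fin m → E)) {w₀ : Fin m → E} (hΨ : ∀ b, Ψ b = φ b *ᵥ w₀)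
    {N n : ℕ} {c : 𝒪[E]} (uO : 𝒪[E]) (lamO : 𝒪[K]) (τ : Matrix (Fin m) (Fin m) E)
    (hτB : φ (RingHom.prodMap (𝒪[E]).subtype (𝒪[K]).subtype ((uO, lamO) : 𝒪[E] × 𝒪[K])) = τ)
    (hR : ((Polynomial.eval₂RingHom (RingHom.prod (RingHom.id 𝒪[E]) jO) (uO, lamO)).range : Set (𝒪[E] × 𝒪[K])) =
      {z : 𝒪[E] × 𝒪[K] | ∃ b₀ c₀ : 𝒪[E], z.2 = jO b₀ + jO c₀ * (jO (ϖO ^ N) * θ) ∧ z.1 - (b₀ + c₀ * c) ∈ Ideal.span {ϖO ^ n}})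
    (hB1 : ∀ Λ : Submodule 𝒪[E] (Fin m → E),
      (∃ g ∈ unitaryGroupOfForm σ (J : Matrix (Fin m) (Fin m) E), Λ = Submodule.span 𝒪[E] (Set.range ((g : Matrix (Fin m) (Fin m) E))ᵀ)) →
        ∃ O : Subring (E × K), (∀ r : 𝒪[E], algebraMap E (E × K) (r : E) ∈ O) ∧
          (O : Set (E × K)) = {x : E × K | Λ.map ((Matrix.toLin' (φ x)).restrictScalars 𝒪[E]) ≤ Λ}) :
    ∀ Λ : Submodule 𝒪[E] (Fin m → E),
      (∃ g ∈ unitaryGroupOfForm σ (J : Matrix (Fin m) (Fin m) E), Λ = Submodule.span 𝒪[E] (Set.range ((g : Matrix (Fin m) (Fin m) E))ᵀ)) →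
        Λ.map ((Matrix.toLin' τ).restrictScalars 𝒪[E]) ≤ Λ →
          ∃ O ∈ (fun S : Subring (𝒪[E] × 𝒪[K]) => S.map (RingHom.prodMap (𝒪[E]).subtype (𝒪[K]).subtype)) ''
              {S : Subring (𝒪[E] × 𝒪[K]) | (∀ y : 𝒪[E], ((y, jO y) : 𝒪[E] × 𝒪[K]) ∈ S) ∧
                {z : 𝒪[E] × 𝒪[K] | ∃ b₀ c₀ : 𝒪[E], z.2 = jO b₀ + jO c₀ * (jO (ϖO ^ N) * θ) ∧ z.1 - (b₀ + c₀ * c) ∈ Ideal.span {ϖO ^ n}} ⊆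
                  (S : Set (𝒪[E] × 𝒪[K]))},
            (O : Set (E × K)) = {x : E × K | Λ.map ((Matrix.toLin' (φ x)).restrictScalars 𝒪[E]) ≤ Λ} := by
  intro Λ hsd hst
  obtain ⟨O, hOsc, hOcoe⟩ := hB1 Λ hsd
  obtain ⟨g, hg, rfl⟩ := hsd
  have hOτ : RingHom.prodMap (𝒪[E]).subtype (𝒪[K]).subtype ((uO, lamO) : 𝒪[E] × 𝒪[K]) ∈ O := by
    rw [← SetLike.mem_coe, hOcoe, Set.mem_setOf_eq, hτB]
    exact hst
  have hOint : (O : Set (E × K)) ⊆ Set.range (RingHom.prodMap (𝒪[E]).subtype (𝒪[K]).subtype) :=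
    coe_subset_range_prodMap_subtype_of_coe_eq hOK φ Ψ hΨ g O hOcoe
  exact ⟨O, mem_image_glued_family_of_subset_range jO hjO θ ϖO uO lamO hR O hOsc hOτ hOint, hOcoe⟩

end Cover

end Literature.NumberTheory.Automorphic

end
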